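import Literature.AlgebraicGeometry.Resolution.QuadraticTransforms
import Mathlib.RingTheory.LocalRing.RingHom.Basic
import Mathlib.Algebra.Group.Units.Equiv
import HarnessLib

/-!
# Crux `Steer` (stmt-ResolutionOfSingularities-16345), chain W4.1, R2 σ_top line: K(2) realisation, layer 2a —
# quadratic transforms are transported along injective homomorphisms of fields (Theses-free helper)

OURS (campaign `res-hironaka`, rung L ★L-G4, slot W4.1, chain W4.1, seat `res-type-026`, TAKEN from
res-L1-type-o8's realisation layer of K(2) by the split on STATUS 2026-08-27T05:25–05:47Z; replaces the role of no
printed item; NOT a statement of the manuscript under review; AI review is weaker than expert review).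

Interface-free TRANSPORT LEMMAS for the realisation of a radicand chain (`L/w41/Sketch-R2-steered.lean`
fb4f9514a6cb98fe §3.1, `NoEternalIsolatedRadicandChain`) inside the fraction field `K′` of the first torsor germ:
the chain's base rings `S m ⊆ L` only lie in the subfield `L₀ = Frac(S 0) ≤ L`, and the realisation maps them
into `K′ ⊇ L₀` — so every structure of the chain (`IsQuadraticTransform`, Cutkosky §2.1, and the principal
extension of the maximal ideal `𝔪_{S m}·S (m+1) = (x m)`) has to be carried along an injective ring homomorphism
defined on `L₀` only. Pure statements about subrings of fields; no definitions.

* `RadicandChainTransport.mem_maximalIdeal_map_iff` / `isLocalRing_map_iff` — for a homomorphism of fields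
  `φ : D → E` and a subring `S ≤ D`: `S.map φ ≃ S`, so locality and the maximal ideal correspond.
* `RadicandChainTransport.map_blowupRing` — `φ(S[𝔪_S/x]) = φ(S)[𝔪_{φ S}/φ x]`.
* `RadicandChainTransport.isQuadraticTransform_map` / `isQuadraticTransform_of_map` — `S → S₁` is a quadratic
  transform in `D` iff `φ S → φ S₁` is one in `E` (both directions are needed: DESCEND from `L` to `L₀` along the
  inclusion, then PUSH to `K′`).
* `RadicandChainTransport.isQuadraticTransform_transport` — the partial form actually consumed: for
  `ι : D → L`, `ψ : D → E` and `S → S₁` a quadratic transform in `L` with `S₁ ≤ ι(D)`, the images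
  `ψ(ι⁻¹ S) → ψ(ι⁻¹ S₁)` form a quadratic transform in `E`.
* `RadicandChainTransport.span_maximalIdeal_transport` — the principal-extension condition
  `(𝔪_S · S₁) = (x)` is carried along a compatible pair of ring isomorphisms `S ≃ A`, `S₁ ≃ A₁`.

[cite: Cutkosky2014, §2.1] [folklore]
-/

noncomputable section

-- `Summit.<S>.<S>.…` duplicates the summit name by design (single-problem summit).
set_option linter.dupNamespace false

open IsLocalRing

namespace Summit.ResolutionOfSingularities.ResolutionOfSingularities.Theorems.SwitchingDichotomy

open Literature.AlgebraicGeometry.Resolution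

namespace RadicandChainTransport

universe u v w

section Map

variable {D : Type u} {E : Type v} [Field D] [Field E] (φ : D →+* E)

/-- `φ(S) ≃ S` is local iff `S` is. [folklore] -/
theorem isLocalRing_map_iff (S : Subring D) : IsLocalRing (S.map φ) ↔ IsLocalRing S := by
  constructor
  · intro h
    exact (S.equivMapOfInjective φ φ.injective).symm.isLocalRing
  · intro h
    exact (S.equivMapOfInjective φ φ.injective).isLocalRing

/-- Under `S ≃ φ(S)` the maximal ideals correspond: `φ y ∈ 𝔪_{φ S} ↔ y ∈ 𝔪_S`. [folklore] -/
theorem mem_maximalIdeal_map_iff {S : Subring D} [IsLocalRing S] [IsLocalRing (S.map φ)] (y : S) :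
    (⟨φ y, y, y.2, rfl⟩ : S.map φ) ∈ maximalIdeal (S.map φ) ↔ y ∈ maximalIdeal S := by
  have he : (S.equivMapOfInjective φ φ.injective) y = ⟨φ y, y, y.2, rfl⟩ := Subtype.ext rfl
  rw [mem_maximalIdeal, mem_maximalIdeal, mem_nonunits_iff, mem_nonunits_iff, ← he,
    MulEquiv.isUnit_map]

/-- An element of `φ(S)` lies in `𝔪_{φ S}` iff it is the image of an element of `𝔪_S`. [folklore] -/
theorem mem_maximalIdeal_map_iff' {S : Subring D} [IsLocalRing S] [IsLocalRing (S.map φ)]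
    (y' : S.map φ) : y' ∈ maximalIdeal (S.map φ) ↔ ∃ y : S, y ∈ maximalIdeal S ∧ φ y = y' := by
  obtain ⟨y, hyS, hyeq⟩ := Subring.mem_map.mp y'.2
  have hy' : y' = ⟨φ y, y, hyS, rfl⟩ := Subtype.ext hyeq.symm
  constructor
  · intro h
    rw [hy'] at h
    exact ⟨⟨y, hyS⟩, (mem_maximalIdeal_map_iff φ ⟨y, hyS⟩).mp h, hyeq⟩
  · rintro ⟨z, hz, hzeq⟩
    have : z = ⟨y, hyS⟩ := Subtype.ext (φ.injective (hzeq.trans hyeq.symm))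
    rw [hy']
    exact (mem_maximalIdeal_map_iff φ ⟨y, hyS⟩).mpr (this ▸ hz)

/-- **The blow-up chart is transported**: `φ(S[𝔪_S/x]) = φ(S)[𝔪_{φ S}/φ x]`. [cite: Cutkosky2014, §2.1]
[folklore] -/
theorem map_blowupRing {S : Subring D} [IsLocalRing S] [IsLocalRing (S.map φ)] (x : D) :
    (blowupRing S x).map φ = blowupRing (S.map φ) (φ x) := by
  apply le_antisymm
  · rw [Subring.map_le_iff_le_comap]
    refine Subring.closure_le.mpr ?_
    rintro z (hz | ⟨y, hy, rfl⟩)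
    · exact Subring.mem_comap.mpr (le_blowupRing _ _ ⟨z, hz, rfl⟩)
    · show φ ((y : D) / x) ∈ blowupRing (S.map φ) (φ x)
      rw [map_div₀]
      exact div_mem_blowupRing (R := S.map φ) (φ x) ((mem_maximalIdeal_map_iff φ y).mpr hy)
  · refine Subring.closure_le.mpr ?_
    rintro z (hz | ⟨y', hy', rfl⟩)
    · obtain ⟨w, hw, rfl⟩ := Subring.mem_map.mp hz
      exact Subring.mem_map.mpr ⟨w, le_blowupRing _ _ hw, rfl⟩
    · obtain ⟨y, hy, hyeq⟩ := (mem_maximalIdeal_map_iff' φ y').mp hy'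
      show (y' : E) / φ x ∈ (blowupRing S x).map φ
      rw [← hyeq, ← map_div₀]
      exact Subring.mem_map.mpr ⟨_, div_mem_blowupRing x hy, rfl⟩

/-- **Quadratic transforms push forward** along a homomorphism of fields `φ : D → E`: if `S → S₁` is a quadratic
transform in `D` then `φ S → φ S₁` is one in `E` (same parameter `φ x`, chart `φ(S[𝔪/x])`, fractions and
domination carried by `φ`). [cite: Cutkosky2014, §2.1] [folklore] -/
theorem isQuadraticTransform_map {S S₁ : Subring D} (h : IsQuadraticTransform S S₁) :
    IsQuadraticTransform (S.map φ) (S₁.map φ) := by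
  obtain ⟨hS, x, hx, hx0, hS₁, hbl, hfrac, hdom⟩ := h
  haveI := hS
  haveI := hS₁
  haveI hS' : IsLocalRing (S.map φ) := (isLocalRing_map_iff φ S).mpr hS
  haveI hS₁' : IsLocalRing (S₁.map φ) := (isLocalRing_map_iff φ S₁).mpr hS₁
  refine ⟨hS', ⟨φ x, x, x.2, rfl⟩, (mem_maximalIdeal_map_iff φ x).mpr hx, ?_, hS₁', ?_, ?_, ?_⟩
  · intro h0
    apply hx0
    have h1 : φ x = 0 := congrArg Subtype.val h0
    exact Subtype.ext ((map_eq_zero φ).mp h1)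
  · show blowupRing (S.map φ) (φ x) ≤ S₁.map φ
    rw [← map_blowupRing φ]
    exact (Subring.gc_map_comap φ).monotone_l hbl
  · intro z' hz'
    obtain ⟨z, hz, rfl⟩ := Subring.mem_map.mp hz'
    obtain ⟨a, ha, b, hb, hbinv, rfl⟩ := hfrac z hz
    refine ⟨φ a, ?_, φ b, ?_, ?_, map_div₀ φ a b⟩
    · show φ a ∈ blowupRing (S.map φ) (φ x)
      rw [← map_blowupRing φ]
      exact Subring.mem_map.mpr ⟨a, ha, rfl⟩
    · show φ b ∈ blowupRing (S.map φ) (φ x)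
      rw [← map_blowupRing φ]
      exact Subring.mem_map.mpr ⟨b, hb, rfl⟩
    · rw [← map_inv₀]
      exact Subring.mem_map.mpr ⟨b⁻¹, hbinv, rfl⟩
  · refine ⟨(Subring.gc_map_comap φ).monotone_l hdom.1, fun y' hy' hinv => ?_⟩
    obtain ⟨y, hy, rfl⟩ := Subring.mem_map.mp hy'
    rw [← map_inv₀] at hinv ⊢
    obtain ⟨w, hw, hweq⟩ := Subring.mem_map.mp hinv
    have hwy : w = y⁻¹ := φ.injective hweq
    exact Subring.mem_map.mpr ⟨y⁻¹, hdom.2 y hy (hwy ▸ hw), rfl⟩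

/-- **Quadratic transforms descend** along a homomorphism of fields `φ : D → E`: if `φ S → φ S₁` is a quadratic
transform in `E` then `S → S₁` is one in `D`. [cite: Cutkosky2014, §2.1] [folklore] -/
theorem isQuadraticTransform_of_map {S S₁ : Subring D} (h : IsQuadraticTransform (S.map φ) (S₁.map φ)) :
    IsQuadraticTransform S S₁ := by
  obtain ⟨hS', x', hx', hx0', hS₁', hbl, hfrac, hdom⟩ := h
  haveI := hS'
  haveI := hS₁'
  haveI hS : IsLocalRing S := (isLocalRing_map_iff φ S).mp hS'
  haveI hS₁ : IsLocalRing S₁ := (isLocalRing_map_iff φ S₁).mp hS₁'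
  obtain ⟨x, hx, hxeq⟩ := (mem_maximalIdeal_map_iff' φ x').mp hx'
  -- membership transport along `φ`
  have hback : ∀ {T : Subring D} {z : D}, φ z ∈ T.map φ → z ∈ T := by
    intro T z hz
    obtain ⟨w, hw, hweq⟩ := Subring.mem_map.mp hz
    exact φ.injective hweq ▸ hw
  have hle : S ≤ S₁ := fun z hz => hback (hdom.1 (Subring.mem_map.mpr ⟨z, hz, rfl⟩))
  have hblow : ∀ {a : E}, a ∈ blowupRing (S.map φ) (x' : E) → ∃ a₀ ∈ blowupRing S (x : D), φ a₀ = a := by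
    intro a ha
    rw [← hxeq, ← map_blowupRing φ] at ha
    exact Subring.mem_map.mp ha
  refine ⟨hS, x, hx, ?_, hS₁, ?_, ?_, ?_⟩
  · intro h0
    apply hx0'
    apply Subtype.ext
    rw [← hxeq, h0]
    exact map_zero φ
  · intro z hz
    apply hback
    apply hbl
    rw [← hxeq, ← map_blowupRing φ]
    exact Subring.mem_map.mpr ⟨z, hz, rfl⟩
  · intro z hz
    obtain ⟨a', ha', b', hb', hbinv', hzeq⟩ := hfrac (φ z) (Subring.mem_map.mpr ⟨z, hz, rfl⟩)
    obtain ⟨a, ha, rfl⟩ := hblow ha'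
    obtain ⟨b, hb, rfl⟩ := hblow hb'
    refine ⟨a, ha, b, hb, ?_, ?_⟩
    · rw [← map_inv₀] at hbinv'
      exact hback hbinv'
    · apply φ.injective
      rw [hzeq, map_div₀]
  · refine ⟨hle, fun y hy hinv => ?_⟩
    have h1 : (φ y)⁻¹ ∈ S₁.map φ := by
      rw [← map_inv₀]; exact Subring.mem_map.mpr ⟨y⁻¹, hinv, rfl⟩
    have h2 := hdom.2 (φ y) (Subring.mem_map.mpr ⟨y, hy, rfl⟩) h1
    rw [← map_inv₀] at h2
    exact hback h2

end Map

section Transport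

variable {D : Type u} {L : Type v} {E : Type w} [Field D] [Field L] [Field E]

/-- **Transport of a quadratic transform along a partial injective map** (the form consumed by the
realisation of a radicand chain): `ι : D → L` and `ψ : D → E` homomorphisms of fields, `S → S₁` a quadratic
transform in `L` with `S₁ ⊆ ι(D)`; then `ψ(ι⁻¹ S) → ψ(ι⁻¹ S₁)` is a quadratic transform in `E`.
[cite: Cutkosky2014, §2.1] [folklore] -/
theorem isQuadraticTransform_transport (ι : D →+* L) (ψ : D →+* E) {S S₁ : Subring L}
    (h : IsQuadraticTransform S S₁) (hS₁ : S₁ ≤ ι.range) :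
    IsQuadraticTransform ((S.comap ι).map ψ) ((S₁.comap ι).map ψ) := by
  have hS : S ≤ ι.range := h.dominates.1.trans hS₁
  have h' : IsQuadraticTransform ((S.comap ι).map ι) ((S₁.comap ι).map ι) := by
    rw [Subring.map_comap_eq_self hS, Subring.map_comap_eq_self hS₁]
    exact h
  exact isQuadraticTransform_map ψ (isQuadraticTransform_of_map ι h')

end Transport

section Span

variable {L : Type u} {K : Type v} [Field L] [Field K]

/-- **The principal-extension condition `𝔪_S · S₁ = (x)` is transported** along a compatible pair of ring
isomorphisms `e₀ : S ≃ A`, `e₁ : S₁ ≃ A₁` (`S ≤ S₁` in `L`, `A ≤ A₁` in `K`, `e₁|_S = e₀`): the ideal of `A₁`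
generated by `𝔪_A` is generated by `e₁ x`. [folklore] -/
theorem span_maximalIdeal_transport {S S₁ : Subring L} {A A₁ : Subring K} [IsLocalRing S] [IsLocalRing A]
    (hle : S ≤ S₁) (hle' : A ≤ A₁) (e₀ : S ≃+* A) (e₁ : S₁ ≃+* A₁)
    (hcomp : ∀ y : S, (e₁ ⟨(y : L), hle y.2⟩ : K) = (e₀ y : K)) (x : S₁)
    (hspan : Ideal.span ((fun y : S => (⟨(y : L), hle y.2⟩ : S₁)) '' (maximalIdeal S : Set S)) =
      Ideal.span {x}) :
    Ideal.span ((fun y : A => (⟨(y : K), hle' y.2⟩ : A₁)) '' (maximalIdeal A : Set A)) =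
      Ideal.span {e₁ x} := by
  have h1 : Ideal.span ((e₁ : S₁ → A₁) '' ((fun y : S => (⟨(y : L), hle y.2⟩ : S₁)) ''
      (maximalIdeal S : Set S))) = Ideal.span {e₁ x} := by
    have h0 := congrArg (Ideal.map (e₁ : S₁ →+* A₁)) hspan
    rw [Ideal.map_span, Ideal.map_span, Set.image_singleton] at h0
    simpa only [RingHom.coe_coe] using h0
  rw [← h1]
  congr 1
  ext a
  constructor
  · rintro ⟨y, hy, rfl⟩
    refine ⟨⟨(e₀.symm y : L), hle (e₀.symm y).2⟩, ⟨e₀.symm y, ?_, rfl⟩, ?_⟩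
    · rw [SetLike.mem_coe, mem_maximalIdeal, mem_nonunits_iff] at hy ⊢
      intro hu
      apply hy
      have := hu.map e₀
      rwa [e₀.apply_symm_apply] at this
    · apply Subtype.ext
      show ((e₁ ⟨(e₀.symm y : L), _⟩ : A₁) : K) = (y : K)
      rw [hcomp, e₀.apply_symm_apply]
  · rintro ⟨_, ⟨y, hy, rfl⟩, rfl⟩
    refine ⟨e₀ y, ?_, ?_⟩
    · rw [SetLike.mem_coe, mem_maximalIdeal, mem_nonunits_iff] at hy ⊢
      intro hu
      exact hy ((MulEquiv.isUnit_map e₀).mp hu)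
    · apply Subtype.ext
      show ((e₀ y : A) : K) = ((e₁ ⟨(y : L), _⟩ : A₁) : K)
      rw [hcomp]

end Span

end RadicandChainTransport

end Summit.ResolutionOfSingularities.ResolutionOfSingularities.Theorems.SwitchingDichotomy

end
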